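import Summits.QuantumFields.BalabanUV.T4Continuum.Support.NE7CombLoopReconstruction
import Summits.QuantumFields.BalabanUV.T4Continuum.Support.NE7EtaBackgroundFlatStratum
import Summits.QuantumFields.BalabanUV.T4Continuum.Support.NE3EnergyRateFlatClass
import Summits.QuantumFields.BalabanUV.T4Continuum.Support.MinimalActionCompact
import HarnessLib

/-!
# NE7FlatLoopCommute — THE LOOP VARIABLES OF A FLAT PERIODIC CONFIGURATION COMMUTE, and their plaquette words are trivial; the matrix-valued loop map is
# continuous (file S3c-2a of the `k`-uniform stabiliser lifting programme: the limit side of the compactness argument for (NEAR-FLAT_K))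

Cell `pub-balaban`, rung (B)+1 sub-cell t4, lineage `b2b-balaban-t4-ne7b-p1` (row NE7b OWNER + CRUX PROVER; junction service for row NE7, ruling R-OWNER-149-1 (2)),
generation 159.  Memo `t4/b2b-balaban-t4-ne7b-p1/g159/records/S3-BRIEF.md` §2 (c).
THE ARGUMENT.  A flat unitary configuration on `ℤ^d` is a pure gauge `1^{w}` (✓ `NE3EnergyRateFlatClass.exists_unitary_gauge_eq_gaugeAct_flatCfg`); if it is `N`-periodic,
`w` is QUASI-periodic, `w(x + N e_i) = w(x)·h_i` (✓ `NE7EtaBackgroundFlatStratum.apply_add_period_eq_of_isPeriodicCfg`), with COMMUTING holonomy constants `h_i`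
(`w(N e_i + N e_j)` two ways), and `w(x + mN e_i) = w(x) h_i^m` (`m ∈ ℤ`).  The axial transport of `1^{w}` is `A(y) = w(0) w(y)⁻¹` (`hol` of the flat configuration is `1`),
so the loop variable `ℓ(r,κ) = A(x_r)·V(x_r,κ)·A((x_r+e_κ)‾)⁻¹` equals `w(0)·(h_κ^{c})⁻¹·w(0)⁻¹`, `c ∈ ℤ` the wrap count of the bond (`x_r + e_κ = (x_r + e_κ)‾_rep + cN e_κ`):
the loop variables COMMUTE.  Their plaquette words are the conjugated plaquette holonomies (✓ `NE7CombLoopReconstruction`), hence `1`.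
WHAT ([folklore]; 0 def, 0 sorry; generic `d`, every `U(n)`).  §1 `hol_flatCfg`, `apply_add_mul_period`, `holonomyConst_comm`, `wrap_vector_eq`; §2 **`loop_eq_conj_of_pureGauge`**,
**`commute_loop_of_flat`**; §3 **`loop_plaqWord_eq_one_of_flat`**; §4 the matrix loop map: `val_loop_eq` (for unitary configurations the matrix expression with `star`
is the loop variable), **`continuous_loopMatrix`**.
HONEST FRAMING (page 1): lattice kinematics; nothing of Bałaban's; NOT (NEAR-FLAT_K), NOT NE7, NOT NE3; row NE7b NOT PRINTED ∕ NOT PROVED; spine 0∕9; finite T⁴ rung (B)+1 — NOT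
infinite volume, NOT mass gap, NOT BetaPertH, NOT Clay.
-/

set_option autoImplicit false

open scoped BigOperators Matrix Matrix.Norms.L2Operator Topology

namespace Summit.QuantumFields.BalabanUV.T4Continuum.NE7FlatLoopCommute

open Literature.MathematicalPhysics.QuantumFieldTheory.Balaban1983to89
open B7Prop1Explicit B7Prop2Explicit
open T4AveragingDeficitWall (IsUnitaryCfg SmallField)
open T4AveragingDeficitWallBoundary (IsPeriodicCfg)
open AveragingDeficitTorusChart (redN redN_boxVec redN_add_smul eq_wrap_add)
open NE3EnergyShapes (IsUnitarySite IsPeriodicSite)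
open MinimalActionWitness (flatCfg)
open MinimalActionCompact (continuous_eval continuous_val_hol)
open NE3EnergyRateFlatClass (exists_unitary_gauge_eq_gaugeAct_flatCfg)
open NE7EtaBackgroundFlatStratum (apply_add_period_eq_of_isPeriodicCfg)
open NE7CombLoopReconstruction (recon_loop hol_recon_plaqWord redN_boxVec_redN_add)

noncomputable section

variable {d : ℕ} {n : Type} [Fintype n] [DecidableEq n]

/-! ## §1 Pure gauges: transport, holonomy constants, wrap vectors -/

/-- The transport of the flat configuration along any word is `1`. [folklore] -/
theorem hol_flatCfg (x : Site d) (w : List (Letter d)) : hol (flatCfg : Site d → Fin d → (Matrix n n ℂ)ˣ) x w = 1 := by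
  induction w generalizing x with
  | nil => rfl
  | cons l w ih =>
      rw [hol_cons, ih]
      obtain ⟨μ, b⟩ := l
      cases b <;> simp [stepHol, flatCfg]

/-- Quasi-periodicity along integer multiples of the period: `w(x + (mN) e_i) = w(x)·h_i^m`, `h_i = w(0)⁻¹ w(N e_i)`. [folklore] -/
theorem apply_add_mul_period {w : Site d → (Matrix n n ℂ)ˣ} {N : ℤ}
    (hper : IsPeriodicCfg (gaugeAct w (flatCfg : Site d → Fin d → (Matrix n n ℂ)ˣ)) N) (x : Site d) (i : Fin d) (m : ℤ) :
    w (x + (m * N) • e i) = w x * ((w 0)⁻¹ * w (N • e i)) ^ m := by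
  induction m using Int.induction_on generalizing x with
  | zero => simp
  | succ m ih =>
      have h1 : x + (((m : ℤ) + 1) * N) • e i = (x + ((m : ℤ) * N) • e i) + N • e i := by
        rw [add_mul, one_mul, add_smul, add_assoc]
      rw [h1, apply_add_period_eq_of_isPeriodicCfg hper, ih, mul_assoc, ← zpow_add_one]
  | pred m ih =>
      have h1 : x + ((-(m : ℤ)) * N) • e i = (x + ((-(m : ℤ) - 1) * N) • e i) + N • e i := by
        rw [sub_mul, one_mul, sub_smul]; abel
      have h2 := apply_add_period_eq_of_isPeriodicCfg hper (x + ((-(m : ℤ) - 1) * N) • e i) i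
      rw [← h1, ih] at h2
      -- `w x h^{-m} = w(x + (-m-1)N e_i) h` ⟹ `w(x + (-m-1)N e_i) = w x h^{-m-1}`
      calc w (x + ((-(m : ℤ) - 1) * N) • e i)
          = w (x + ((-(m : ℤ) - 1) * N) • e i) * ((w 0)⁻¹ * w (N • e i)) * ((w 0)⁻¹ * w (N • e i))⁻¹ := by group
        _ = w x * ((w 0)⁻¹ * w (N • e i)) ^ (-(m : ℤ)) * ((w 0)⁻¹ * w (N • e i))⁻¹ := by rw [← h2]
        _ = w x * ((w 0)⁻¹ * w (N • e i)) ^ (-(m : ℤ) - 1) := by rw [zpow_sub_one, mul_assoc]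

/-- The holonomy constants of a periodic pure gauge COMMUTE: `h_i h_j = h_j h_i`. [folklore] -/
theorem holonomyConst_comm {w : Site d → (Matrix n n ℂ)ˣ} {N : ℤ}
    (hper : IsPeriodicCfg (gaugeAct w (flatCfg : Site d → Fin d → (Matrix n n ℂ)ˣ)) N) (i j : Fin d) :
    ((w 0)⁻¹ * w (N • e i)) * ((w 0)⁻¹ * w (N • e j)) = ((w 0)⁻¹ * w (N • e j)) * ((w 0)⁻¹ * w (N • e i)) := by
  have h1 := apply_add_period_eq_of_isPeriodicCfg hper (N • e i) j
  have h2 := apply_add_period_eq_of_isPeriodicCfg hper (N • e j) i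
  rw [add_comm, h1] at h2
  -- `h2 : w(N e_i)·h_j = w(N e_j)·h_i`
  calc (w 0)⁻¹ * w (N • e i) * ((w 0)⁻¹ * w (N • e j)) = (w 0)⁻¹ * (w (N • e i) * ((w 0)⁻¹ * w (N • e j))) := by group
    _ = (w 0)⁻¹ * (w (N • e j) * ((w 0)⁻¹ * w (N • e i))) := by rw [h2]
    _ = (w 0)⁻¹ * w (N • e j) * ((w 0)⁻¹ * w (N • e i)) := by group

/-- **THE WRAP VECTOR OF A BOND OF THE PERIOD BOX**: `x_r + e_κ = (x_r + e_κ)‾_rep + (cN)·e_κ` with `c = (r_κ + 1) / N ∈ ℤ`. [folklore] -/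
theorem wrap_vector_eq (N : ℕ) [NeZero N] (r : Fin d → Fin N) (κ : Fin d) :
    boxVec N r + e κ = boxVec N (redN N (boxVec N r + e κ)) + ((((r κ : ℕ) : ℤ) + 1) / (N : ℤ) * (N : ℤ)) • e κ := by
  have h := eq_wrap_add (d := d) N (boxVec N r + e κ)
  have hq : (fun i => (boxVec (d := d) N r + e κ) i / (N : ℤ)) = ((((r κ : ℕ) : ℤ) + 1) / (N : ℤ)) • e κ := by
    funext i
    by_cases hi : i = κ
    · subst hi
      simp [boxVec, e]
    · have h0 : (e κ : Site d) i = 0 := by simp [e, hi]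
      have hr : (0 : ℤ) ≤ ((r i : ℕ) : ℤ) ∧ ((r i : ℕ) : ℤ) < (N : ℤ) := ⟨by positivity, by exact_mod_cast (r i).isLt⟩
      simp only [Pi.add_apply, h0, add_zero, Pi.smul_apply, smul_eq_mul, mul_zero, boxVec]
      exact Int.ediv_eq_zero_of_lt hr.1 hr.2
  conv_lhs => rw [h]
  rw [hq, smul_smul, mul_comm]

/-! ## §2 The loop variables of a periodic pure gauge -/

/-- **THE LOOP VARIABLE OF A PERIODIC PURE GAUGE IS A CONJUGATED POWER OF A HOLONOMY CONSTANT**: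
`A(r) (1^{w})(x_r,κ) A((x_r+e_κ)‾)⁻¹ = w(0) (h_κ^{c})⁻¹ w(0)⁻¹`, `A(r) = hol (1^{w}) 0 (treeWord x_r)`, `c` the wrap count. [folklore] -/
theorem loop_eq_conj_of_pureGauge (N : ℕ) [NeZero N] {w : Site d → (Matrix n n ℂ)ˣ}
    (hper : IsPeriodicCfg (gaugeAct w (flatCfg : Site d → Fin d → (Matrix n n ℂ)ˣ)) (N : ℤ)) (r : Fin d → Fin N) (κ : Fin d) :
    hol (gaugeAct w (flatCfg : Site d → Fin d → (Matrix n n ℂ)ˣ)) 0 (treeWord (boxVec N r)) * gaugeAct w flatCfg (boxVec N r) κ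
        * (hol (gaugeAct w (flatCfg : Site d → Fin d → (Matrix n n ℂ)ˣ)) 0 (treeWord (boxVec N (redN N (boxVec N r + e κ)))))⁻¹
      = w 0 * (((w 0)⁻¹ * w ((N : ℤ) • e κ)) ^ ((((r κ : ℕ) : ℤ) + 1) / (N : ℤ)))⁻¹ * (w 0)⁻¹ := by
  have hA : ∀ y : Site d, hol (gaugeAct w (flatCfg : Site d → Fin d → (Matrix n n ℂ)ˣ)) 0 (treeWord y) = w 0 * (w y)⁻¹ := by
    intro y
    rw [hol_gaugeAct, hol_flatCfg, disp_treeWord, zero_add, mul_one]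
  have hb : gaugeAct w (flatCfg : Site d → Fin d → (Matrix n n ℂ)ˣ) (boxVec N r) κ = w (boxVec N r) * (w (boxVec N r + e κ))⁻¹ := by
    simp [gaugeAct, flatCfg]
  have hwrap : w (boxVec N r + e κ) = w (boxVec N (redN N (boxVec N r + e κ))) * ((w 0)⁻¹ * w ((N : ℤ) • e κ)) ^ ((((r κ : ℕ) : ℤ) + 1) / (N : ℤ)) := by
    conv_lhs => rw [wrap_vector_eq N r κ]
    exact apply_add_mul_period hper _ κ _
  rw [hA, hA, hb, hwrap]
  group

/-- **THE LOOP VARIABLES OF A FLAT UNITARY PERIODIC CONFIGURATION COMMUTE** (axial transport). [folklore] -/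
theorem commute_loop_of_flat [Nonempty n] (N : ℕ) [NeZero N] {V : Site d → Fin d → (Matrix n n ℂ)ˣ} (hVu : IsUnitaryCfg V)
    (hVP : IsPeriodicCfg V (N : ℤ)) (hflat : SmallField V 0) (r r' : Fin d → Fin N) (κ κ' : Fin d) :
    (hol V 0 (treeWord (boxVec N r)) * V (boxVec N r) κ * (hol V 0 (treeWord (boxVec N (redN N (boxVec N r + e κ)))))⁻¹)
        * (hol V 0 (treeWord (boxVec N r')) * V (boxVec N r') κ' * (hol V 0 (treeWord (boxVec N (redN N (boxVec N r' + e κ')))))⁻¹)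
      = (hol V 0 (treeWord (boxVec N r')) * V (boxVec N r') κ' * (hol V 0 (treeWord (boxVec N (redN N (boxVec N r' + e κ')))))⁻¹)
        * (hol V 0 (treeWord (boxVec N r)) * V (boxVec N r) κ * (hol V 0 (treeWord (boxVec N (redN N (boxVec N r + e κ)))))⁻¹) := by
  have hflat' : ∀ (x : Site d) (μ ν : Fin d), μ ≠ ν → hol V x (plaqWord μ ν) = 1 := by
    intro x μ ν hμν
    have h0 := hflat x μ ν hμν
    exact Units.ext (sub_eq_zero.mp (norm_le_zero_iff.mp h0))
  obtain ⟨w, -, hVw⟩ := exists_unitary_gauge_eq_gaugeAct_flatCfg hVu hflat'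
  subst hVw
  rw [loop_eq_conj_of_pureGauge N hVP, loop_eq_conj_of_pureGauge N hVP]
  have hc : Commute ((w 0)⁻¹ * w ((N : ℤ) • e κ)) ((w 0)⁻¹ * w ((N : ℤ) • e κ')) := holonomyConst_comm hVP κ κ'
  have hz := (hc.zpow_zpow ((((r κ : ℕ) : ℤ) + 1) / (N : ℤ)) ((((r' κ' : ℕ) : ℤ) + 1) / (N : ℤ))).inv_inv
  calc w 0 * (((w 0)⁻¹ * w ((N : ℤ) • e κ)) ^ ((((r κ : ℕ) : ℤ) + 1) / (N : ℤ)))⁻¹ * (w 0)⁻¹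
        * (w 0 * (((w 0)⁻¹ * w ((N : ℤ) • e κ')) ^ ((((r' κ' : ℕ) : ℤ) + 1) / (N : ℤ)))⁻¹ * (w 0)⁻¹)
      = w 0 * ((((w 0)⁻¹ * w ((N : ℤ) • e κ)) ^ ((((r κ : ℕ) : ℤ) + 1) / (N : ℤ)))⁻¹
          * (((w 0)⁻¹ * w ((N : ℤ) • e κ')) ^ ((((r' κ' : ℕ) : ℤ) + 1) / (N : ℤ)))⁻¹) * (w 0)⁻¹ := by group
    _ = w 0 * ((((w 0)⁻¹ * w ((N : ℤ) • e κ')) ^ ((((r' κ' : ℕ) : ℤ) + 1) / (N : ℤ)))⁻¹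
          * (((w 0)⁻¹ * w ((N : ℤ) • e κ)) ^ ((((r κ : ℕ) : ℤ) + 1) / (N : ℤ)))⁻¹) * (w 0)⁻¹ := by rw [hz.eq]
    _ = _ := by group

/-! ## §3 Plaquette words of the loop family of a flat configuration -/

/-- **THE PLAQUETTE WORDS OF THE LOOP FAMILY ARE CONJUGATED PLAQUETTE HOLONOMIES**, for ANY residue-indexed transport `A`. [folklore] -/
theorem loop_plaqWord_eq (N : ℕ) [NeZero N] (A : (Fin d → Fin N) → (Matrix n n ℂ)ˣ) {V : Site d → Fin d → (Matrix n n ℂ)ˣ}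
    (hVP : IsPeriodicCfg V (N : ℤ)) (x : Site d) (κ μ : Fin d) :
    (A (redN N x) * V (boxVec N (redN N x)) κ * (A (redN N (boxVec N (redN N x) + e κ)))⁻¹)
      * (A (redN N (x + e κ)) * V (boxVec N (redN N (x + e κ))) μ * (A (redN N (boxVec N (redN N (x + e κ)) + e μ)))⁻¹)
      * (A (redN N (x + e μ)) * V (boxVec N (redN N (x + e μ))) κ * (A (redN N (boxVec N (redN N (x + e μ)) + e κ)))⁻¹)⁻¹
      * (A (redN N x) * V (boxVec N (redN N x)) μ * (A (redN N (boxVec N (redN N x) + e μ)))⁻¹)⁻¹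
      = A (redN N x) * hol V x (plaqWord κ μ) * (A (redN N x))⁻¹ := by
  -- `V` is the reconstruction of its loop family
  set f : (Fin d → Fin N) → Fin d → (Matrix n n ℂ)ˣ := fun r ν => A r * V (boxVec N r) ν * (A (redN N (boxVec N r + e ν)))⁻¹ with hf
  have hVeq : V = fun (y : Site d) (ν : Fin d) => (A (redN N y))⁻¹ * f (redN N y) ν * A (redN N (y + e ν)) := by
    funext y ν; exact (recon_loop N A hVP y ν).symm
  conv_rhs => rw [hVeq]
  rw [hol_recon_plaqWord N A f x κ μ]
  simp only [hf]
  group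

/-- **FOR A FLAT CONFIGURATION THE PLAQUETTE WORDS OF THE LOOP FAMILY ARE `1`.** [folklore] -/
theorem loop_plaqWord_eq_one_of_flat (N : ℕ) [NeZero N] (A : (Fin d → Fin N) → (Matrix n n ℂ)ˣ) {V : Site d → Fin d → (Matrix n n ℂ)ˣ}
    (hVP : IsPeriodicCfg V (N : ℤ)) (hflat : SmallField V 0) (x : Site d) {κ μ : Fin d} (hκμ : κ ≠ μ) :
    (A (redN N x) * V (boxVec N (redN N x)) κ * (A (redN N (boxVec N (redN N x) + e κ)))⁻¹)
      * (A (redN N (x + e κ)) * V (boxVec N (redN N (x + e κ))) μ * (A (redN N (boxVec N (redN N (x + e κ)) + e μ)))⁻¹)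
      * (A (redN N (x + e μ)) * V (boxVec N (redN N (x + e μ))) κ * (A (redN N (boxVec N (redN N (x + e μ)) + e κ)))⁻¹)⁻¹
      * (A (redN N x) * V (boxVec N (redN N x)) μ * (A (redN N (boxVec N (redN N x) + e μ)))⁻¹)⁻¹ = 1 := by
  rw [loop_plaqWord_eq N A hVP]
  have h1 : hol V x (plaqWord κ μ) = 1 := Units.ext (sub_eq_zero.mp (norm_le_zero_iff.mp (hflat x κ μ hκμ)))
  rw [h1, mul_one, mul_inv_cancel]

/-! ## §4 The matrix loop map -/

/-- For a UNITARY configuration the matrix expression with `star` for the inverse transport IS the loop variable. [folklore] -/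
theorem val_loop_eq (N : ℕ) [NeZero N] {V : Site d → Fin d → (Matrix n n ℂ)ˣ} (hVu : IsUnitaryCfg V) (r : Fin d → Fin N) (κ : Fin d) :
    ((hol V 0 (treeWord (boxVec N r)) * V (boxVec N r) κ * (hol V 0 (treeWord (boxVec N (redN N (boxVec N r + e κ)))))⁻¹ : (Matrix n n ℂ)ˣ) :
        Matrix n n ℂ)
      = ((hol V 0 (treeWord (boxVec N r)) : (Matrix n n ℂ)ˣ) : Matrix n n ℂ) * (V (boxVec N r) κ : Matrix n n ℂ)
          * star ((hol V 0 (treeWord (boxVec N (redN N (boxVec N r + e κ)))) : (Matrix n n ℂ)ˣ) : Matrix n n ℂ) := by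
  have hu : ((hol V 0 (treeWord (boxVec N (redN N (boxVec N r + e κ)))) : (Matrix n n ℂ)ˣ) : Matrix n n ℂ) ∈ unitary (Matrix n n ℂ) :=
    mem_unitaryUnits.mp (hol_mem_of hVu _ _)
  have hinv : (↑((hol V 0 (treeWord (boxVec N (redN N (boxVec N r + e κ)))))⁻¹) : Matrix n n ℂ)
      = star ((hol V 0 (treeWord (boxVec N (redN N (boxVec N r + e κ)))) : (Matrix n n ℂ)ˣ) : Matrix n n ℂ) :=
    Units.inv_eq_of_mul_eq_one_right (Unitary.mul_star_self_of_mem hu)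
  simp only [Units.val_mul, hinv]

/-- The matrix loop map `U ↦ hol U 0 (treeWord x_r) · U(x_r,κ) · (hol U 0 (treeWord (x_r+e_κ)‾_rep))⋆` is continuous (product topology). [folklore] -/
theorem continuous_loopMatrix (N : ℕ) [NeZero N] (r : Fin d → Fin N) (κ : Fin d) :
    Continuous fun U : Site d → Fin d → (Matrix n n ℂ)ˣ =>
      ((hol U 0 (treeWord (boxVec N r)) : (Matrix n n ℂ)ˣ) : Matrix n n ℂ) * (U (boxVec N r) κ : Matrix n n ℂ)
        * star ((hol U 0 (treeWord (boxVec N (redN N (boxVec N r + e κ)))) : (Matrix n n ℂ)ˣ) : Matrix n n ℂ) :=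
  ((continuous_val_hol (d := d) (n := n) 0 _).mul (Units.continuous_val.comp (continuous_eval (boxVec N r) κ))).mul
    ((continuous_val_hol (d := d) (n := n) 0 _).star)

end

end Summit.QuantumFields.BalabanUV.T4Continuum.NE7FlatLoopCommute
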